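import Mathlib
import HarnessLib
import Summits.CriticalPhenomena.PercolationContinuityZ3.Theorems.PercNearOneGluingNoHeavyLowerTailAntipodalHarris

/-!
# Antipodal interface gluing: the fibrewise SPLIT inequality across an excluding one-vertex interface

Helper file for crux `stmt-CriticalPhenomena-4575` (`NoHeavyLowerTail`, route `PercNearOneGluingNoHeavy`),
new-inequality factory seat `prim-ineq-gen-1` (gen 8).  Everything here is PROVED; no route definition is touched.
Memo: `run/shared/lean/prim/prim-ineq-gen-1/FINDING-14-core-lemma-refuted.md` §6.

**Background.**  The fibrewise ("antipodal", `ρ = -1`) form of the van den Berg–Häggström–Kahn SPLIT inequality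
(`μ(av|bc) μ(a|b|c|v) ≤ μ(av|b|c) μ(a|v|bc)`, BHK 2006 Thm 2.1 at `q = 1`) asks, for the uniform 2-colouring
`(Y, Yᶜ)` of the edges of a finite multigraph with terminal pairs `S = {a,v}`, `T = {b,c}`, that on the event
"no monochromatic `S`–`T` path in either colour" the colour preferences of the two pairs are NEGATIVELY correlated:
`Σ_Y 1_𝒩(Y) α(Y) γ(Y) ≤ 0` with `α = [a ~_red v] − [a ~_blue v]`, `γ = [b ~_red c] − [b ~_blue c]`
(conjecture T2 of the memos; exhaustively verified for `n ≤ 7`, open in general; every one-sided class decomposition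
of it is refuted in FINDING-14).

**This file** proves the abstract form of the one mechanism that IS rigorous: when a single vertex `w` separates the
`S`-side edge set `ι` from the `T`-side edge set `κ`, the colouring factorises, `a ~ v` is an up-set `𝒜 ⊆ 2^ι`,
`b ~ c` an up-set `𝒢 ⊆ 2^κ`, "`w` is red-joined to `S`" an up-set `ℛ ⊆ 2^ι`, "`w` is red-joined to `T`" an up-set
`𝒯 ⊆ 2^κ`, blue events are the same sets evaluated at complements, and "no monochromatic cross" is the EXCLUSION
weight `excl(X,W) = [¬(X ∈ ℛ ∧ W ∈ 𝒯)] [¬(Xᶜ ∈ ℛ ∧ Wᶜ ∈ 𝒯)]`.  Then (`sum_excl_mul_pref_mul_pref_nonpos`)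

  `Σ_{X ⊆ ι} Σ_{W ⊆ κ} excl(X,W) · α(X) · γ(W) ≤ 0`,   `α(X) := 1_𝒜(X) − 1_𝒜(Xᶜ)`, `γ(W) := 1_𝒢(W) − 1_𝒢(Wᶜ)`,

for ALL up-sets `𝒜, ℛ ⊆ 2^ι`, `𝒢, 𝒯 ⊆ 2^κ` ("antiferromagnetic interface": same-colour contact across the interface
is forbidden, so the two colour preferences anti-align).  Proof: expanding `excl = (1 − r t)(1 − r' t')` and using the
antipodal symmetry `X ↦ Xᶜ` the double sum equals `−2 · P_S · P_T` (`sum_excl_mul_mul_eq`, valid for any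
antisymmetric `α, γ`) with `P_S = Σ_{X ∈ ℛ} α(X) =
#(ℛ ∩ 𝒜) − #(ℛ ∩ σ𝒜) ≥ 0` by the antipodal Harris inequality (`AntipodalHarris.card_inter_antipode_le`,
Harris–Kleitman twice), and likewise `P_T ≥ 0`.  In particular T2 holds for every multigraph in which a cut vertex
separates `{a,v}` from `{b,c}` (FINDING-14 §6, "toy theorem"); the general conjecture needs a two-sided argument of
this kind without a fixed interface.  (Found and proved by this seat, 2026-08-20.)
-/

namespace Summit.CriticalPhenomena.PercolationContinuityZ3.Theorems

namespace AntipodalInterfaceGluing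

open Finset AntipodalHarris

variable {ι : Type*} [DecidableEq ι] [Fintype ι]

/-- Re-indexing a sum over the Boolean lattice by the antipodal map `X ↦ Xᶜ`. [this work] -/
theorem sum_comp_compl (f : Finset ι → ℤ) : ∑ X : Finset ι, f Xᶜ = ∑ X : Finset ι, f X :=
  Fintype.sum_equiv ⟨compl, compl, compl_compl, compl_compl⟩ _ _ (fun _ => rfl)

/-- An antisymmetric summand (`f Xᶜ = -f X`) has zero sum over the Boolean lattice. [this work] -/
theorem sum_eq_zero_of_antisymm (f : Finset ι → ℤ) (hf : ∀ X, f Xᶜ = -f X) : ∑ X : Finset ι, f X = 0 := by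
  have h := sum_comp_compl f
  have h2 : ∑ X : Finset ι, f Xᶜ = -∑ X : Finset ι, f X := by
    rw [← Finset.sum_neg_distrib]
    exact Finset.sum_congr rfl (fun X _ => hf X)
  omega

/-- For antisymmetric `α`: `Σ_X 1_ℛ(X) 1_ℛ(Xᶜ) α X = 0`. [this work] -/
theorem sum_ind_ind_compl_mul_eq_zero (ℛ : Finset (Finset ι)) (α : Finset ι → ℤ) (hα : ∀ X, α Xᶜ = -α X) :
    ∑ X : Finset ι, (if X ∈ ℛ then (1 : ℤ) else 0) * (if Xᶜ ∈ ℛ then (1 : ℤ) else 0) * α X = 0 := by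
  apply sum_eq_zero_of_antisymm
  intro X
  rw [compl_compl, hα]
  ring

/-- For antisymmetric `α`: `Σ_X 1_ℛ(Xᶜ) α X = − Σ_X 1_ℛ(X) α X`. [this work] -/
theorem sum_ind_compl_mul (ℛ : Finset (Finset ι)) (α : Finset ι → ℤ) (hα : ∀ X, α Xᶜ = -α X) :
    ∑ X : Finset ι, (if Xᶜ ∈ ℛ then (1 : ℤ) else 0) * α X =
      -∑ X : Finset ι, (if X ∈ ℛ then (1 : ℤ) else 0) * α X := by
  have h := sum_comp_compl (fun X => (if X ∈ ℛ then (1 : ℤ) else 0) * α Xᶜ)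
  simp only [compl_compl] at h
  rw [h, ← Finset.sum_neg_distrib]
  refine Finset.sum_congr rfl (fun X _ => ?_)
  rw [hα]
  ring

/-- The colour preference `1_𝒜(X) − 1_𝒜(Xᶜ)` of an event is antisymmetric under the antipodal map. [this work] -/
theorem pref_compl (𝒜 : Finset (Finset ι)) (X : Finset ι) :
    ((if Xᶜ ∈ 𝒜 then (1 : ℤ) else 0) - (if Xᶜᶜ ∈ 𝒜 then (1 : ℤ) else 0)) =
      -((if X ∈ 𝒜 then (1 : ℤ) else 0) - (if Xᶜ ∈ 𝒜 then (1 : ℤ) else 0)) := by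
  rw [compl_compl]
  ring

/-- The one-sided Harris input: for up-sets `ℛ, 𝒜`,
`P := Σ_{X ∈ ℛ} (1_𝒜(X) − 1_𝒜(Xᶜ)) = #(ℛ ∩ 𝒜) − #(ℛ ∩ σ𝒜) ≥ 0` (antipodal Harris inequality:
"`w` red-joined to `S` makes the red `a`–`v` connection likelier than the blue one"). [this work] -/
theorem sum_ind_mul_pref_nonneg {ℛ 𝒜 : Finset (Finset ι)} (hℛ : IsUpperSet (ℛ : Set (Finset ι)))
    (h𝒜 : IsUpperSet (𝒜 : Set (Finset ι))) :
    0 ≤ ∑ X : Finset ι, (if X ∈ ℛ then (1 : ℤ) else 0) *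
      ((if X ∈ 𝒜 then (1 : ℤ) else 0) - (if Xᶜ ∈ 𝒜 then (1 : ℤ) else 0)) := by
  have h := sum_harrisKernel_antipodal_nonneg hℛ h𝒜
  refine h.trans (le_of_eq (Finset.sum_congr rfl (fun X _ => ?_)))
  by_cases h1 : X ∈ ℛ <;> by_cases h2 : X ∈ 𝒜 <;> by_cases h3 : Xᶜ ∈ 𝒜 <;> simp [h1, h2, h3]

variable {κ : Type*} [DecidableEq κ] [Fintype κ]

/-- The exclusion indicator is `(1 − r t)(1 − r' t')` in `0/1` arithmetic. [this work] -/
theorem excl_eq (ℛ : Finset (Finset ι)) (𝒯 : Finset (Finset κ)) (X : Finset ι) (W : Finset κ) :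
    (if ¬(X ∈ ℛ ∧ W ∈ 𝒯) ∧ ¬(Xᶜ ∈ ℛ ∧ Wᶜ ∈ 𝒯) then (1 : ℤ) else 0) =
      (1 - (if X ∈ ℛ then (1 : ℤ) else 0) * (if W ∈ 𝒯 then (1 : ℤ) else 0)) *
        (1 - (if Xᶜ ∈ ℛ then (1 : ℤ) else 0) * (if Wᶜ ∈ 𝒯 then (1 : ℤ) else 0)) := by
  by_cases h1 : X ∈ ℛ <;> by_cases h2 : W ∈ 𝒯 <;> by_cases h3 : Xᶜ ∈ ℛ <;> by_cases h4 : Wᶜ ∈ 𝒯 <;>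
    simp [h1, h2, h3, h4]

omit [DecidableEq ι] [DecidableEq κ] in
/-- Double sums of products factor. [this work] -/
theorem sum_sum_mul (f : Finset ι → ℤ) (g : Finset κ → ℤ) :
    ∑ X : Finset ι, ∑ W : Finset κ, f X * g W = (∑ X : Finset ι, f X) * (∑ W : Finset κ, g W) := by
  rw [Finset.sum_mul_sum]

/-- **Interface identity.**  For any antisymmetric statistics `α` on `2^ι` and `γ` on `2^κ` and any `ℛ ⊆ 2^ι`,
`𝒯 ⊆ 2^κ`, the exclusion-weighted antipodal sum factorises:
`Σ_X Σ_W [¬(X∈ℛ ∧ W∈𝒯)][¬(Xᶜ∈ℛ ∧ Wᶜ∈𝒯)] α(X) γ(W) = −2 · (Σ_{X∈ℛ} α X) · (Σ_{W∈𝒯} γ W)`. [new] -/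
theorem sum_excl_mul_mul_eq (ℛ : Finset (Finset ι)) (𝒯 : Finset (Finset κ)) (α : Finset ι → ℤ)
    (γ : Finset κ → ℤ) (hα : ∀ X, α Xᶜ = -α X) (hγ : ∀ W, γ Wᶜ = -γ W) :
    ∑ X : Finset ι, ∑ W : Finset κ,
        (if ¬(X ∈ ℛ ∧ W ∈ 𝒯) ∧ ¬(Xᶜ ∈ ℛ ∧ Wᶜ ∈ 𝒯) then (1 : ℤ) else 0) * α X * γ W =
      -2 * ((∑ X : Finset ι, (if X ∈ ℛ then (1 : ℤ) else 0) * α X) *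
        (∑ W : Finset κ, (if W ∈ 𝒯 then (1 : ℤ) else 0) * γ W)) := by
  have key : ∀ X : Finset ι, ∀ W : Finset κ,
      (if ¬(X ∈ ℛ ∧ W ∈ 𝒯) ∧ ¬(Xᶜ ∈ ℛ ∧ Wᶜ ∈ 𝒯) then (1 : ℤ) else 0) * α X * γ W =
        α X * γ W - ((if X ∈ ℛ then (1 : ℤ) else 0) * α X) * ((if W ∈ 𝒯 then (1 : ℤ) else 0) * γ W)
          - ((if Xᶜ ∈ ℛ then (1 : ℤ) else 0) * α X) * ((if Wᶜ ∈ 𝒯 then (1 : ℤ) else 0) * γ W)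
          + ((if X ∈ ℛ then (1 : ℤ) else 0) * (if Xᶜ ∈ ℛ then (1 : ℤ) else 0) * α X) *
            ((if W ∈ 𝒯 then (1 : ℤ) else 0) * (if Wᶜ ∈ 𝒯 then (1 : ℤ) else 0) * γ W) := by
    intro X W
    rw [excl_eq]
    ring
  have h1 : ∑ X : Finset ι, ∑ W : Finset κ,
        (if ¬(X ∈ ℛ ∧ W ∈ 𝒯) ∧ ¬(Xᶜ ∈ ℛ ∧ Wᶜ ∈ 𝒯) then (1 : ℤ) else 0) * α X * γ W =
      ∑ X : Finset ι, ∑ W : Finset κ,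
        (α X * γ W - ((if X ∈ ℛ then (1 : ℤ) else 0) * α X) * ((if W ∈ 𝒯 then (1 : ℤ) else 0) * γ W)
          - ((if Xᶜ ∈ ℛ then (1 : ℤ) else 0) * α X) * ((if Wᶜ ∈ 𝒯 then (1 : ℤ) else 0) * γ W)
          + ((if X ∈ ℛ then (1 : ℤ) else 0) * (if Xᶜ ∈ ℛ then (1 : ℤ) else 0) * α X) *
            ((if W ∈ 𝒯 then (1 : ℤ) else 0) * (if Wᶜ ∈ 𝒯 then (1 : ℤ) else 0) * γ W)) :=
    Finset.sum_congr rfl (fun X _ => Finset.sum_congr rfl (fun W _ => key X W))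
  rw [h1]
  simp only [Finset.sum_add_distrib, Finset.sum_sub_distrib, sum_sum_mul]
  rw [sum_eq_zero_of_antisymm α hα, sum_ind_ind_compl_mul_eq_zero ℛ α hα, sum_ind_compl_mul ℛ α hα,
    sum_ind_compl_mul 𝒯 γ hγ]
  ring

/-- **Antipodal interface gluing (fibrewise SPLIT across an excluding cut vertex).**  For up-sets `𝒜, ℛ ⊆ 2^ι`
and `𝒢, 𝒯 ⊆ 2^κ`, with the colour preferences `α(X) = 1_𝒜(X) − 1_𝒜(Xᶜ)`, `γ(W) = 1_𝒢(W) − 1_𝒢(Wᶜ)` and the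
exclusion weight `[¬(X ∈ ℛ ∧ W ∈ 𝒯)] [¬(Xᶜ ∈ ℛ ∧ Wᶜ ∈ 𝒯)]` (no same-colour contact at the interface):
`Σ_X Σ_W excl · α(X) · γ(W) ≤ 0` — the two colour preferences are negatively correlated.  The sum equals
`−2 P_S P_T` with `P_S, P_T ≥ 0` by the antipodal Harris inequality. [new] -/
theorem sum_excl_mul_pref_mul_pref_nonpos {𝒜 ℛ : Finset (Finset ι)} {𝒢 𝒯 : Finset (Finset κ)}
    (h𝒜 : IsUpperSet (𝒜 : Set (Finset ι))) (hℛ : IsUpperSet (ℛ : Set (Finset ι)))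
    (h𝒢 : IsUpperSet (𝒢 : Set (Finset κ))) (h𝒯 : IsUpperSet (𝒯 : Set (Finset κ))) :
    ∑ X : Finset ι, ∑ W : Finset κ,
        (if ¬(X ∈ ℛ ∧ W ∈ 𝒯) ∧ ¬(Xᶜ ∈ ℛ ∧ Wᶜ ∈ 𝒯) then (1 : ℤ) else 0) *
          ((if X ∈ 𝒜 then (1 : ℤ) else 0) - (if Xᶜ ∈ 𝒜 then (1 : ℤ) else 0)) *
          ((if W ∈ 𝒢 then (1 : ℤ) else 0) - (if Wᶜ ∈ 𝒢 then (1 : ℤ) else 0)) ≤ 0 := by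
  rw [sum_excl_mul_mul_eq ℛ 𝒯 _ _ (pref_compl 𝒜) (pref_compl 𝒢)]
  have hS := sum_ind_mul_pref_nonneg hℛ h𝒜
  have hT := sum_ind_mul_pref_nonneg h𝒯 h𝒢
  nlinarith [mul_nonneg hS hT]

/-- Pointwise expansion of the product of two colour preferences into the four "exactly one colour on each side"
patterns: `(1_𝒜(X) − 1_𝒜(Xᶜ))(1_𝒢(W) − 1_𝒢(Wᶜ)) = RR − RB − BR + BB`. [this work] -/
theorem pref_mul_pref_eq (𝒜 : Finset (Finset ι)) (𝒢 : Finset (Finset κ)) (X : Finset ι) (W : Finset κ) :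
    ((if X ∈ 𝒜 then (1 : ℤ) else 0) - (if Xᶜ ∈ 𝒜 then (1 : ℤ) else 0)) *
        ((if W ∈ 𝒢 then (1 : ℤ) else 0) - (if Wᶜ ∈ 𝒢 then (1 : ℤ) else 0)) =
      (if X ∈ 𝒜 ∧ Xᶜ ∉ 𝒜 ∧ W ∈ 𝒢 ∧ Wᶜ ∉ 𝒢 then (1 : ℤ) else 0)
        - (if X ∈ 𝒜 ∧ Xᶜ ∉ 𝒜 ∧ W ∉ 𝒢 ∧ Wᶜ ∈ 𝒢 then (1 : ℤ) else 0)
        - (if X ∉ 𝒜 ∧ Xᶜ ∈ 𝒜 ∧ W ∈ 𝒢 ∧ Wᶜ ∉ 𝒢 then (1 : ℤ) else 0)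
        + (if X ∉ 𝒜 ∧ Xᶜ ∈ 𝒜 ∧ W ∉ 𝒢 ∧ Wᶜ ∈ 𝒢 then (1 : ℤ) else 0) := by
  by_cases h1 : X ∈ 𝒜 <;> by_cases h2 : Xᶜ ∈ 𝒜 <;> by_cases h3 : W ∈ 𝒢 <;> by_cases h4 : Wᶜ ∈ 𝒢 <;>
    simp [h1, h2, h3, h4]

omit [DecidableEq ι] [DecidableEq κ] in
/-- Re-indexing a double sum over two Boolean lattices by the simultaneous antipodal map. [this work] -/
theorem sum_sum_comp_compl [DecidableEq ι] [DecidableEq κ] (f : Finset ι → Finset κ → ℤ) :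
    ∑ X : Finset ι, ∑ W : Finset κ, f Xᶜ Wᶜ = ∑ X : Finset ι, ∑ W : Finset κ, f X W := by
  rw [sum_comp_compl (fun X => ∑ W : Finset κ, f X Wᶜ)]
  exact Finset.sum_congr rfl (fun X _ => sum_comp_compl (f X))

/-- **Fibrewise SPLIT across an excluding cut vertex (counting form).**  For up-sets `𝒜, ℛ ⊆ 2^ι`, `𝒢, 𝒯 ⊆ 2^κ`
and the exclusion weight `excl(X,W) = [¬(X∈ℛ ∧ W∈𝒯)][¬(Xᶜ∈ℛ ∧ Wᶜ∈𝒯)]`: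
`#{(X,W) : excl, X ∈ 𝒜, Xᶜ ∉ 𝒜, W ∈ 𝒢, Wᶜ ∉ 𝒢} ≤ #{(X,W) : excl, X ∈ 𝒜, Xᶜ ∉ 𝒜, W ∉ 𝒢, Wᶜ ∈ 𝒢}` — in the
glued-graph reading (`𝒜 = {a ~ v}`, `𝒢 = {b ~ c}`, `ℛ, 𝒯` = "the cut vertex is joined to `S` / to `T`"): the number
of colourings with red `av|bc`, blue `a|b|c|v` is at most the number with red `av|b|c`, blue `a|v|bc`, i.e. the SPLIT
count inequality `A ≤ B` of the memos for every multigraph in which a vertex separates `{a,v}` from `{b,c}`. [new] -/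
theorem glued_split_count_le {𝒜 ℛ : Finset (Finset ι)} {𝒢 𝒯 : Finset (Finset κ)}
    (h𝒜 : IsUpperSet (𝒜 : Set (Finset ι))) (hℛ : IsUpperSet (ℛ : Set (Finset ι)))
    (h𝒢 : IsUpperSet (𝒢 : Set (Finset κ))) (h𝒯 : IsUpperSet (𝒯 : Set (Finset κ))) :
    ∑ X : Finset ι, ∑ W : Finset κ,
        (if ¬(X ∈ ℛ ∧ W ∈ 𝒯) ∧ ¬(Xᶜ ∈ ℛ ∧ Wᶜ ∈ 𝒯) then (1 : ℤ) else 0) *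
          (if X ∈ 𝒜 ∧ Xᶜ ∉ 𝒜 ∧ W ∈ 𝒢 ∧ Wᶜ ∉ 𝒢 then (1 : ℤ) else 0) ≤
      ∑ X : Finset ι, ∑ W : Finset κ,
        (if ¬(X ∈ ℛ ∧ W ∈ 𝒯) ∧ ¬(Xᶜ ∈ ℛ ∧ Wᶜ ∈ 𝒯) then (1 : ℤ) else 0) *
          (if X ∈ 𝒜 ∧ Xᶜ ∉ 𝒜 ∧ W ∉ 𝒢 ∧ Wᶜ ∈ 𝒢 then (1 : ℤ) else 0) := by
  -- abbreviations for the exclusion weight and the four patterns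
  set e : Finset ι → Finset κ → ℤ :=
    fun X W => if ¬(X ∈ ℛ ∧ W ∈ 𝒯) ∧ ¬(Xᶜ ∈ ℛ ∧ Wᶜ ∈ 𝒯) then (1 : ℤ) else 0 with he
  set rr : Finset ι → Finset κ → ℤ :=
    fun X W => if X ∈ 𝒜 ∧ Xᶜ ∉ 𝒜 ∧ W ∈ 𝒢 ∧ Wᶜ ∉ 𝒢 then (1 : ℤ) else 0 with hrr
  set rb : Finset ι → Finset κ → ℤ :=
    fun X W => if X ∈ 𝒜 ∧ Xᶜ ∉ 𝒜 ∧ W ∉ 𝒢 ∧ Wᶜ ∈ 𝒢 then (1 : ℤ) else 0 with hrb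
  set br : Finset ι → Finset κ → ℤ :=
    fun X W => if X ∉ 𝒜 ∧ Xᶜ ∈ 𝒜 ∧ W ∈ 𝒢 ∧ Wᶜ ∉ 𝒢 then (1 : ℤ) else 0 with hbr
  set bb : Finset ι → Finset κ → ℤ :=
    fun X W => if X ∉ 𝒜 ∧ Xᶜ ∈ 𝒜 ∧ W ∉ 𝒢 ∧ Wᶜ ∈ 𝒢 then (1 : ℤ) else 0 with hbb
  -- the exclusion weight is invariant under the simultaneous antipodal map
  have he_symm : ∀ X : Finset ι, ∀ W : Finset κ, e Xᶜ Wᶜ = e X W := by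
    intro X W
    simp only [he, compl_compl]
    by_cases h1 : X ∈ ℛ <;> by_cases h2 : W ∈ 𝒯 <;> by_cases h3 : Xᶜ ∈ ℛ <;> by_cases h4 : Wᶜ ∈ 𝒯 <;>
      simp [h1, h2, h3, h4]
  -- bb is rr at the antipodes, br is rb at the antipodes
  have hbb' : ∀ X : Finset ι, ∀ W : Finset κ, bb X W = rr Xᶜ Wᶜ := by
    intro X W
    simp only [hbb, hrr, compl_compl]
    by_cases h1 : X ∈ 𝒜 <;> by_cases h2 : Xᶜ ∈ 𝒜 <;> by_cases h3 : W ∈ 𝒢 <;> by_cases h4 : Wᶜ ∈ 𝒢 <;>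
      simp [h1, h2, h3, h4]
  have hbr' : ∀ X : Finset ι, ∀ W : Finset κ, br X W = rb Xᶜ Wᶜ := by
    intro X W
    simp only [hbr, hrb, compl_compl]
    by_cases h1 : X ∈ 𝒜 <;> by_cases h2 : Xᶜ ∈ 𝒜 <;> by_cases h3 : W ∈ 𝒢 <;> by_cases h4 : Wᶜ ∈ 𝒢 <;>
      simp [h1, h2, h3, h4]
  have sbb : ∑ X : Finset ι, ∑ W : Finset κ, e X W * bb X W = ∑ X : Finset ι, ∑ W : Finset κ, e X W * rr X W := by
    rw [← sum_sum_comp_compl (fun X W => e X W * rr X W)]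
    exact Finset.sum_congr rfl (fun X _ => Finset.sum_congr rfl (fun W _ => by rw [hbb', he_symm]))
  have sbr : ∑ X : Finset ι, ∑ W : Finset κ, e X W * br X W = ∑ X : Finset ι, ∑ W : Finset κ, e X W * rb X W := by
    rw [← sum_sum_comp_compl (fun X W => e X W * rb X W)]
    exact Finset.sum_congr rfl (fun X _ => Finset.sum_congr rfl (fun W _ => by rw [hbr', he_symm]))
  -- the kernel sum equals 2 (RR − RB)
  have main := sum_excl_mul_pref_mul_pref_nonpos h𝒜 hℛ h𝒢 h𝒯
  have hker : ∑ X : Finset ι, ∑ W : Finset κ,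
        (if ¬(X ∈ ℛ ∧ W ∈ 𝒯) ∧ ¬(Xᶜ ∈ ℛ ∧ Wᶜ ∈ 𝒯) then (1 : ℤ) else 0) *
          ((if X ∈ 𝒜 then (1 : ℤ) else 0) - (if Xᶜ ∈ 𝒜 then (1 : ℤ) else 0)) *
          ((if W ∈ 𝒢 then (1 : ℤ) else 0) - (if Wᶜ ∈ 𝒢 then (1 : ℤ) else 0)) =
      ∑ X : Finset ι, ∑ W : Finset κ, (e X W * rr X W - e X W * rb X W - e X W * br X W + e X W * bb X W) := by
    refine Finset.sum_congr rfl (fun X _ => Finset.sum_congr rfl (fun W _ => ?_))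
    rw [mul_assoc, pref_mul_pref_eq]
    simp only [he, hrr, hrb, hbr, hbb]
    ring
  rw [hker] at main
  simp only [Finset.sum_add_distrib, Finset.sum_sub_distrib] at main
  rw [sbb, sbr] at main
  have : ∑ X : Finset ι, ∑ W : Finset κ, e X W * rr X W ≤ ∑ X : Finset ι, ∑ W : Finset κ, e X W * rb X W := by
    linarith
  simpa only [he, hrr, hrb] using this

end AntipodalInterfaceGluing

end Summit.CriticalPhenomena.PercolationContinuityZ3.Theorems
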